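import Literature.Barriers.AnomalousDissipation.TwoDimensionalEnergyDissipation
import Literature.Analysis.FluidPDE.AlexakisDoering
import Literature.Analysis.FluidPDE.AlexakisDoeringProofs
import Literature.Analysis.FluidPDE.AlexakisDoeringEnstrophyHolds
import Literature.Analysis.FluidPDE.NSEnstrophyBalance2DGalerkin
import Literature.Analysis.FluidPDE.NSUniqueness2DProofs
import HarnessLib

/-!
# Barrier (AnomalousDissipation): assembly of the Alexakis–Doering energy dissipation bound

Proof layer for the barrier fact
`Literature.Barriers.AnomalousDissipation.AlexakisDoering2006_energyDissipationBound`
(`TwoDimensionalEnergyDissipation`): the final step of Alexakis–Doering, Phys. Lett. A 359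
(2006), §2 — "Combining (trickI) with (Xbound) we deduce `⟨ω²⟩² ≤ k_f U⁵ ν⁻¹ (C₁ + C₂/Re)`, and
in terms of the energy dissipation rate this is the announced result
`β ≤ Re^{-1/2}(C₁ + C₂/Re)^{1/2}`" — carried out on the tree's renderings:

* `AlexakisDoering2006_energyDissipationBound_of`: the accepted enstrophy bound
  `Literature.Analysis.FluidPDE.alexakis_doering_enstrophy_bound` ("(Xbound)", turb.S25) and
  the interpolation fact `Literature.Analysis.FluidPDE.AlexakisDoering2006_dissipation_sq_le`
  ("(trickI)", `ε² ≤ ν U² χ`) imply the barrier fact with the same constants: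
  `ε ≤ (ν U² χ)^{1/2} ≤ (ν U² · alexakisDoeringRHS C₁ C₂ ν U ℓ)^{1/2}`.
* `AlexakisDoering2006_energyDissipationBound_of_steps`: the same from the three displayed
  steps "(VBI)", "(F1a)", "(trickI)" of §2 (`Literature.Analysis.FluidPDE.AlexakisDoering`), via
  `Literature.Analysis.FluidPDE.alexakis_doering_enstrophy_bound_of`.

* `AlexakisDoering2006_energyDissipationBound_of_enstrophyBalance`: with the proofs of the three
  steps in `Literature.Analysis.FluidPDE.AlexakisDoeringProofs` — "(F1a)" (arXiv v1 eq. (18))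
  unconditionally (`AlexakisDoering2006_amplitude_le_holds`), "(VBI)" (eq. (16)) and "(trickI)"
  (eq. (21)) from the 2-D strong-regularity / enstrophy-balance fact
  `Literature.Analysis.FluidPDE.fmrt_enstrophy_balance_torus2` (Foias–Manley–Rosa–Temam 2001,
  Ch. II Thm. 7.4, (A.65); `NSEnstrophyBalance2D`) — the barrier follows from that single
  named fact, and so does the "no two-dimensional zeroth law" corollary
  (`no_twoDimensional_zerothLaw_of_enstrophyBalance`).

So the trust base of the barrier is reduced to ONE named fact, the 2-D theory of strong solutions
(global `L²_t H²_x` regularity and the enstrophy equation for Leray–Hopf solutions with smooth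
data); the discharge `AlexakisDoering2006_energyDissipationBound_holds` is the last item below.

* `AlexakisDoering2006_energyDissipationBound_of_lionsProdi`: the existence half of that theory
  is now PROVED in the tree — a global Leray–Hopf solution obeying the integrated enstrophy
  inequality `ν∫₀ᵗ‖Δu‖₂² ≤ ½‖∇u₀‖₂² - ∫₀ᵗ∫⟪Δf, u⟫` with `∫₀ᵗ‖Δu‖₂² < ∞`, by the Galerkin method
  (`Literature.Analysis.FluidPDE.exists_isGlobalLerayHopf_enstrophyIneq_fin_two`,
  `NSEnstrophyLimit2D`; FMRT Thm. 7.4 and (A.65), Kuksin–Shirikyan Thm. 2.1.18), and transferred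
  to every Leray–Hopf solution under 2-D uniqueness
  (`Literature.Analysis.FluidPDE.lions_prodi_uniqueness_torus2.enstrophyIneq`,
  `AlexakisDoeringEnstrophyHolds`) — so the only unproved input left is 2-D UNIQUENESS,
  `Literature.Analysis.FluidPDE.lions_prodi_uniqueness_torus2` (FMRT Thm. 7.3; Lions–Prodi 1959):
  "(VBI)" is `AlexakisDoering2006_enstrophyDissipation_le_of_lionsProdi` (op. cit.), "(trickI)" is
  `AlexakisDoering2006_dissipation_sq_le_of_lionsProdi` below (the `L²(0,T;H²)` regularity it
  consumes follows from `∫₀ᵀ‖Δu‖₂² < ∞` and the `L^∞L²` bound,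
  `memL2Sobolev_two_of_lionsProdi`), and "(F1a)" is unconditional.

* `AlexakisDoering2006_energyDissipationBound_holds`: the DISCHARGE. Two-dimensional uniqueness
  is now proved in the tree (`Literature.Analysis.FluidPDE.lions_prodi_uniqueness_torus2_holds`,
  `NSUniqueness2DProofs`: Ladyzhenskaya's inequality, the energy inequality for the difference
  of two Leray–Hopf solutions, Grönwall), so `AlexakisDoering2006_energyDissipationBound_of_lionsProdi`
  closes the barrier fact with no named-fact input left; `no_twoDimensional_zerothLaw` is the
  unconditional form of the corollary
  `AlexakisDoering2006_energyDissipationBound.no_twoDimensional_zerothLaw`.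

## References

* A. Alexakis, C. R. Doering, Phys. Lett. A 359 (2006), §2 (arXiv:physics/0605090).
-/

open MeasureTheory Set Filter
open scoped ENNReal NNReal

noncomputable section

namespace Literature.Barriers.AnomalousDissipation

open Literature.Analysis.FluidPDE

/-- Elementary real algebra of the final step: `0 ≤ ε`, `ε² ≤ ν U² χ`, `χ ≤ R` and `0 ≤ ν U²`
give `ε ≤ (ν U² R)^{1/2}` (Alexakis–Doering 2006, §2, last display). [cite: AlexakisDoering2006PLA, §2 final display] -/
theorem le_sqrt_of_sq_le_mul {ε ν U χ R : ℝ} (hε : 0 ≤ ε) (hν : 0 ≤ ν)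
    (hsq : ε ^ 2 ≤ ν * U ^ 2 * χ) (hχ : χ ≤ R) :
    ε ≤ Real.sqrt (ν * U ^ 2 * R) := by
  have h1 : ν * U ^ 2 * χ ≤ ν * U ^ 2 * R :=
    mul_le_mul_of_nonneg_left hχ (mul_nonneg hν (sq_nonneg U))
  have h2 : |ε| ≤ Real.sqrt (ν * U ^ 2 * R) := Real.abs_le_sqrt (hsq.trans h1)
  rwa [abs_of_nonneg hε] at h2

/-- **Assembly of the barrier from "(Xbound)" and "(trickI)"** (Alexakis–Doering, Phys. Lett.
A 359 (2006), §2: "Combining (trickI) with (Xbound) we deduce `⟨ω²⟩² ≤ k_f U⁵ν⁻¹(C₁ + C₂/Re)`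
… `β ≤ Re^{-1/2}(C₁ + C₂/Re)^{1/2}`"). The accepted enstrophy dissipation bound
`Literature.Analysis.FluidPDE.alexakis_doering_enstrophy_bound` (`χ ≤ c₁U³/ℓ³ + c₂νU²/ℓ⁴`) and the interpolation fact
`Literature.Analysis.FluidPDE.AlexakisDoering2006_dissipation_sq_le` (`ε² ≤ ν U² χ`) imply
`AlexakisDoering2006_energyDissipationBound` with `C₁ = c₁`, `C₂ = c₂`:
`ε ≤ (ν U² (c₁U³/ℓ³ + c₂νU²/ℓ⁴))^{1/2}` (`ε ≥ 0` by `meanDissipation_nonneg`). [cite: AlexakisDoering2006PLA, §2 final display] -/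
theorem AlexakisDoering2006_energyDissipationBound_of (h₁ : alexakis_doering_enstrophy_bound)
    (h₂ : AlexakisDoering2006_dissipation_sq_le) : AlexakisDoering2006_energyDissipationBound := by
  intro Φ
  obtain ⟨c₁, c₂, hc₁, hc₂, hb⟩ := h₁ Φ
  refine ⟨c₁, c₂, hc₁, hc₂, fun ν hν n hn F u₀ u hu₀ hu hU => ?_⟩
  exact le_sqrt_of_sq_le_mul (meanDissipation_nonneg hν.le u) hν.le
    (h₂ Φ hν hn F u₀ u hu₀ hu hU) (hb ν hν n hn F u₀ u hu₀ hu hU)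

/-- **Assembly of the barrier from the three displayed steps of §2** ("(VBI)" `χ ≤ k_f² U F`,
"(F1a)" `F ≤ a'U²k_f + b'νUk_f²`, "(trickI)" `ε² ≤ νU²χ`; Alexakis–Doering 2006, §2): the three
named facts of `Literature.Analysis.FluidPDE.AlexakisDoering` imply
`AlexakisDoering2006_energyDissipationBound` (with `C₁ = a a'`, `C₂ = a b'`), through
`alexakis_doering_enstrophy_bound_of`. [cite: AlexakisDoering2006PLA, §2] -/
theorem AlexakisDoering2006_energyDissipationBound_of_steps
    (h₁ : AlexakisDoering2006_enstrophyDissipation_le) (h₂ : AlexakisDoering2006_amplitude_le)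
    (h₃ : AlexakisDoering2006_dissipation_sq_le) : AlexakisDoering2006_energyDissipationBound :=
  AlexakisDoering2006_energyDissipationBound_of (alexakis_doering_enstrophy_bound_of h₁ h₂) h₃

/-- **No two-dimensional zeroth law, from the three steps of §2**: under the three named facts,
along any family `ν_j → 0` of such flows with `0 < U_j ≤ Ū` the mean energy dissipation tends to
`0` (the proved corollary `AlexakisDoering2006_energyDissipationBound.no_twoDimensional_zerothLaw`
fed with `AlexakisDoering2006_energyDissipationBound_of_steps`; Alexakis–Doering 2006, §1–2,
`β ≲ Re^{-1/2}`). [cite: AlexakisDoering2006PLA, §1 and §2] -/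
theorem no_twoDimensional_zerothLaw_of_steps
    (h₁ : AlexakisDoering2006_enstrophyDissipation_le) (h₂ : AlexakisDoering2006_amplitude_le)
    (h₃ : AlexakisDoering2006_dissipation_sq_le) (Φ : ForcingShape (Fin 2)) {n : ℕ}
    (hn : 0 < n) (F : ℝ) (ν : ℕ → ℝ) (hν : ∀ j, 0 < ν j) (hν₀ : Tendsto ν atTop (nhds 0))
    (u₀ : ℕ → UnitAddTorus (Fin 2) → EuclideanSpace ℝ (Fin 2))
    (u : ℕ → ℝ → UnitAddTorus (Fin 2) → EuclideanSpace ℝ (Fin 2))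
    (hu₀ : ∀ j, Literature.Analysis.FunctionSpaces.Torus.IsSmooth (u₀ j))
    (hu : ∀ j, Torus.IsGlobalLerayHopf (ν j) (fun _ => Φ.force n F) (u₀ j) (u j))
    {Ubar : ℝ} (hU : ∀ j, 0 < rmsVelocity longTimeAvgSup (u j) ∧
      rmsVelocity longTimeAvgSup (u j) ≤ Ubar) :
    Tendsto (fun j => meanDissipation (ν j) (u j)) atTop (nhds 0) :=
  (AlexakisDoering2006_energyDissipationBound_of_steps h₁ h₂ h₃).no_twoDimensional_zerothLaw
    Φ hn F ν hν hν₀ u₀ u hu₀ hu hU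

/-- **The barrier from the single 2-D regularity fact**: the named fact
`Literature.Analysis.FluidPDE.fmrt_enstrophy_balance_torus2` (Foias–Manley–Rosa–Temam 2001,
Ch. II Thm. 7.4 and (A.65): `L²(0,T;H²)` regularity and the integrated enstrophy equation of 2-D
Leray–Hopf solutions with smooth data) implies `AlexakisDoering2006_energyDissipationBound`
(Alexakis–Doering 2006, §2): the amplitude step is proved unconditionally
(`AlexakisDoering2006_amplitude_le_holds`), the enstrophy-dissipation and interpolation steps
from the fact (`AlexakisDoering2006_enstrophyDissipation_le_of_enstrophyBalance`,
`AlexakisDoering2006_dissipation_sq_le_of_enstrophyBalance`). [cite: AlexakisDoering2006PLA, §2] -/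
theorem AlexakisDoering2006_energyDissipationBound_of_enstrophyBalance
    (hR : fmrt_enstrophy_balance_torus2) : AlexakisDoering2006_energyDissipationBound :=
  AlexakisDoering2006_energyDissipationBound_of_steps
    (AlexakisDoering2006_enstrophyDissipation_le_of_enstrophyBalance hR)
    AlexakisDoering2006_amplitude_le_holds
    (AlexakisDoering2006_dissipation_sq_le_of_enstrophyBalance hR)

/-- **No two-dimensional zeroth law, from the single 2-D regularity fact**: under
`fmrt_enstrophy_balance_torus2`, along any family `ν_j → 0` of 2-D Leray–Hopf flows driven by
`F Φ(n • x)` with smooth data and `0 < U_j ≤ Ū`, the mean energy dissipation tends to `0`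
(Alexakis–Doering 2006, §1–2, `β ≲ Re^{-1/2}`). [cite: AlexakisDoering2006PLA, §1 and §2] -/
theorem no_twoDimensional_zerothLaw_of_enstrophyBalance (hR : fmrt_enstrophy_balance_torus2)
    (Φ : ForcingShape (Fin 2)) {n : ℕ} (hn : 0 < n) (F : ℝ) (ν : ℕ → ℝ) (hν : ∀ j, 0 < ν j)
    (hν₀ : Tendsto ν atTop (nhds 0))
    (u₀ : ℕ → UnitAddTorus (Fin 2) → EuclideanSpace ℝ (Fin 2))
    (u : ℕ → ℝ → UnitAddTorus (Fin 2) → EuclideanSpace ℝ (Fin 2))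
    (hu₀ : ∀ j, Literature.Analysis.FunctionSpaces.Torus.IsSmooth (u₀ j))
    (hu : ∀ j, Torus.IsGlobalLerayHopf (ν j) (fun _ => Φ.force n F) (u₀ j) (u j))
    {Ubar : ℝ} (hU : ∀ j, 0 < rmsVelocity longTimeAvgSup (u j) ∧
      rmsVelocity longTimeAvgSup (u j) ≤ Ubar) :
    Tendsto (fun j => meanDissipation (ν j) (u j)) atTop (nhds 0) :=
  (AlexakisDoering2006_energyDissipationBound_of_enstrophyBalance hR).no_twoDimensional_zerothLaw
    Φ hn F ν hν hν₀ u₀ u hu₀ hu hU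

/-! ### The barrier from two-dimensional uniqueness alone

The Galerkin construction of a global Leray–Hopf solution with the enstrophy inequality
(`exists_isGlobalLerayHopf_enstrophyIneq_fin_two`, `NSEnstrophyLimit2D`) and its transfer to every
Leray–Hopf solution under uniqueness (`lions_prodi_uniqueness_torus2.enstrophyIneq`,
`AlexakisDoeringEnstrophyHolds`) leave 2-D uniqueness (`lions_prodi_uniqueness_torus2`, FMRT 2001
Ch. II Thm. 7.3) as the only unproved input of the barrier. -/

section Uniqueness

open Literature.Analysis.FunctionSpaces
open scoped RealInnerProductSpace

variable {ν : ℝ} {f : UnitAddTorus (Fin 2) → EuclideanSpace ℝ (Fin 2)}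
  {u₀ : UnitAddTorus (Fin 2) → EuclideanSpace ℝ (Fin 2)}
  {u : ℝ → UnitAddTorus (Fin 2) → EuclideanSpace ℝ (Fin 2)}

/-- **`L²(0,T;H²)` regularity of every 2-D Leray–Hopf solution, from uniqueness.** Under
`lions_prodi_uniqueness_torus2` (Foias–Manley–Rosa–Temam 2001, Ch. II Thm. 7.3): on `𝕋²`, for
`ν > 0`, a smooth steady force `f` and a datum `u₀ ∈ L²` with `‖∇u₀‖₂ < ∞`, weakly divergence
free, every global Leray–Hopf solution `u` lies in `L²(0,T;H²)` for every `T > 0` (spectrally,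
`Torus.MemL2Sobolev 0 T 2` of the complexified field; FMRT (7.16)–(7.17): "the solution is
actually strong … `u ∈ L²(0,T;D(A))`"): `∫₀ᵀ‖Δu‖₂² < ∞` by
`lions_prodi_uniqueness_torus2.enstrophyIneq`, and the `L^∞L²` bound of Leray–Hopf solutions
(`memL2Sobolev_two_of_lintegral_eLaplacianNormSq_lt_top`). [cite: FoiasManleyRosaTemam2001, Ch. II Thm. 7.3–7.4, (7.16)–(7.17)] -/
theorem memL2Sobolev_two_of_lionsProdi (hUq : lions_prodi_uniqueness_torus2) (hν : 0 < ν)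
    (hf : Torus.IsSmooth f) (hu₀ : MemLp u₀ 2 volume) (hG : Torus.eGradNormSq u₀ ≠ ⊤)
    (hdiv : Torus.IsWeaklyDivFree u₀) (hu : Torus.IsGlobalLerayHopf ν (fun _ => f) u₀ u)
    {T : ℝ} (hT : 0 < T) :
    Torus.MemL2Sobolev 0 T 2 (fun t => EuclideanSpace.complexify ∘ u t) := by
  obtain ⟨C, hC⟩ := (hu T hT).energy_bound
  refine memL2Sobolev_two_of_lintegral_eLaplacianNormSq_lt_top ?_ ENNReal.coe_ne_top hC
    (hu T hT).aemeasurable_eLaplacianNormSq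
    (lt_top_iff_ne_top.2 (hUq.enstrophyIneq hν hf hu₀ hG hdiv hu hT).1)
  filter_upwards [ae_restrict_mem measurableSet_Ioo] with s hs
  exact hu.memLp_two hs.1.le

/-- **"(trickI)" `ε² ≤ ν U² χ` from 2-D uniqueness**: under `lions_prodi_uniqueness_torus2` the
Alexakis–Doering fact `AlexakisDoering2006_dissipation_sq_le` holds (Alexakis–Doering 2006, §2,
arXiv v1 eq. (21)): the rescaled force `F Φ(n • x)` is smooth (`ForcingShape.force_regular_holds`),
the smooth datum is in `L² ∩ H¹` and weakly divergence free, and the regularity and the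
enstrophy inequality of every Leray–Hopf solution (`memL2Sobolev_two_of_lionsProdi`,
`lions_prodi_uniqueness_torus2.enstrophyIneq`) feed the proved reduction
`meanDissipation_sq_le_of_enstrophyIneq`. Compared with
`AlexakisDoering2006_dissipation_sq_le_of_enstrophyBalance` the trust base shrinks from the full
2-D regularity fact `fmrt_enstrophy_balance_torus2` to 2-D uniqueness alone. [cite: AlexakisDoering2006PLA, §2 eq. (21)] -/
theorem AlexakisDoering2006_dissipation_sq_le_of_lionsProdi
    (hUq : lions_prodi_uniqueness_torus2) : AlexakisDoering2006_dissipation_sq_le := by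
  intro Φ ν hν n hn F u₀ u hu₀ hu hU
  obtain ⟨hsm, -, -⟩ := ForcingShape.force_regular_holds Φ hn F
  have hG : Torus.eGradNormSq u₀ ≠ ⊤ := (Torus.eGradNormSq_lt_top hu₀).ne
  exact meanDissipation_sq_le_of_enstrophyIneq hν hsm hu
    (fun T hT => memL2Sobolev_two_of_lionsProdi hUq hν hsm (hu₀.memLp 2) hG
      hu.isWeaklyDivFree_datum hu hT)
    (fun t ht => (hUq.enstrophyIneq hν hsm (hu₀.memLp 2) hG hu.isWeaklyDivFree_datum hu ht).2)
    hU

/-- **The barrier from 2-D uniqueness alone**: the named fact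
`Literature.Analysis.FluidPDE.lions_prodi_uniqueness_torus2` (Foias–Manley–Rosa–Temam 2001,
Ch. II Thm. 7.3; Lions–Prodi 1959) implies `AlexakisDoering2006_energyDissipationBound`
(Alexakis–Doering 2006, §2, `β ≤ Re^{-1/2}(C₁ + C₂/Re)^{1/2}`): "(F1a)" is proved unconditionally
(`AlexakisDoering2006_amplitude_le_holds`), "(VBI)" and "(trickI)" from uniqueness plus the proved
Galerkin existence theorem with the enstrophy inequality
(`AlexakisDoering2006_enstrophyDissipation_le_of_lionsProdi`,
`AlexakisDoering2006_dissipation_sq_le_of_lionsProdi`). [cite: AlexakisDoering2006PLA, §2] -/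
theorem AlexakisDoering2006_energyDissipationBound_of_lionsProdi
    (hUq : lions_prodi_uniqueness_torus2) : AlexakisDoering2006_energyDissipationBound :=
  AlexakisDoering2006_energyDissipationBound_of_steps
    (AlexakisDoering2006_enstrophyDissipation_le_of_lionsProdi hUq)
    AlexakisDoering2006_amplitude_le_holds
    (AlexakisDoering2006_dissipation_sq_le_of_lionsProdi hUq)

/-- **No two-dimensional zeroth law, from 2-D uniqueness alone**: under
`lions_prodi_uniqueness_torus2`, along any family `ν_j → 0` of 2-D Leray–Hopf flows driven by
`F Φ(n • x)` with smooth data and `0 < U_j ≤ Ū`, the mean energy dissipation tends to `0`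
(Alexakis–Doering 2006, §1–2, `β ≲ Re^{-1/2}`). [cite: AlexakisDoering2006PLA, §1 and §2] -/
theorem no_twoDimensional_zerothLaw_of_lionsProdi (hUq : lions_prodi_uniqueness_torus2)
    (Φ : ForcingShape (Fin 2)) {n : ℕ} (hn : 0 < n) (F : ℝ) (ν : ℕ → ℝ) (hν : ∀ j, 0 < ν j)
    (hν₀ : Tendsto ν atTop (nhds 0))
    (u₀ : ℕ → UnitAddTorus (Fin 2) → EuclideanSpace ℝ (Fin 2))
    (u : ℕ → ℝ → UnitAddTorus (Fin 2) → EuclideanSpace ℝ (Fin 2))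
    (hu₀ : ∀ j, Torus.IsSmooth (u₀ j))
    (hu : ∀ j, Torus.IsGlobalLerayHopf (ν j) (fun _ => Φ.force n F) (u₀ j) (u j))
    {Ubar : ℝ} (hU : ∀ j, 0 < rmsVelocity longTimeAvgSup (u j) ∧
      rmsVelocity longTimeAvgSup (u j) ≤ Ubar) :
    Tendsto (fun j => meanDissipation (ν j) (u j)) atTop (nhds 0) :=
  (AlexakisDoering2006_energyDissipationBound_of_lionsProdi hUq).no_twoDimensional_zerothLaw
    Φ hn F ν hν hν₀ u₀ u hu₀ hu hU

end Uniqueness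

/-! ### The discharge

With two-dimensional uniqueness proved (`lions_prodi_uniqueness_torus2_holds`,
`NSUniqueness2DProofs`; Foias–Manley–Rosa–Temam 2001, Ch. II Thm. 7.3), every hypothesis of the
chain above is a theorem of the tree: the barrier fact is closed. -/

section Discharge

/-- **The Alexakis–Doering energy dissipation bound, discharged** (Alexakis–Doering, Phys.
Lett. A 359 (2006), §2, final display: `β ≤ Re^{-1/2}(C₁ + C₂ Re⁻¹)^{1/2}`, arXiv v1 eqs.
(16), (18)–(21)): for every forcing shape `Φ` on `T²` there are `C₁, C₂ > 0` such that every
global Leray–Hopf solution of the 2-D Navier–Stokes equations driven by `F Φ(n • x)` from a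
smooth datum, with `U > 0`, has mean energy dissipation
`ε ≤ (ν U² (C₁ U³ n³ + C₂ ν U² n⁴))^{1/2}`. Proof: `AlexakisDoering2006_energyDissipationBound_of_lionsProdi`
— "(F1a)" unconditionally (`AlexakisDoering2006_amplitude_le_holds`), "(VBI)" and "(trickI)"
from the Galerkin solution with the enstrophy inequality transferred to every Leray–Hopf
solution by uniqueness — fed with the tree's proof of the Lions–Prodi uniqueness theorem on `𝕋²`
(`Literature.Analysis.FluidPDE.lions_prodi_uniqueness_torus2_holds`; Foias–Manley–Rosa–Temam
2001, Ch. II Thm. 7.3). [cite: AlexakisDoering2006PLA, §2 final display] -/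
theorem AlexakisDoering2006_energyDissipationBound_holds : AlexakisDoering2006_energyDissipationBound :=
  AlexakisDoering2006_energyDissipationBound_of_lionsProdi lions_prodi_uniqueness_torus2_holds

/-- **No two-dimensional zeroth law** (unconditional): for every forcing shape `Φ` on `T²`,
scale `ℓ = 1/n`, amplitude `F`, viscosities `ν_j > 0` with `ν_j → 0`, smooth data and global
Leray–Hopf solutions `u_j` of the 2-D Navier–Stokes equations driven by `F Φ(n • x)` with
`0 < U_j ≤ Ū`, the mean energy dissipation rates tend to zero, `⟨ν_j‖∇u_j‖₂²⟩ → 0`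
(Alexakis–Doering 2006, §1–2: `β ≲ Re^{-1/2}`, "there is no residual dissipation in the
vanishing viscosity limit"). The proved corollary
`AlexakisDoering2006_energyDissipationBound.no_twoDimensional_zerothLaw` fed with the discharge
`AlexakisDoering2006_energyDissipationBound_holds`. [cite: AlexakisDoering2006PLA, §1 and §2] -/
theorem no_twoDimensional_zerothLaw (Φ : ForcingShape (Fin 2)) {n : ℕ} (hn : 0 < n) (F : ℝ)
    (ν : ℕ → ℝ) (hν : ∀ j, 0 < ν j) (hν₀ : Tendsto ν atTop (nhds 0))
    (u₀ : ℕ → UnitAddTorus (Fin 2) → EuclideanSpace ℝ (Fin 2))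
    (u : ℕ → ℝ → UnitAddTorus (Fin 2) → EuclideanSpace ℝ (Fin 2))
    (hu₀ : ∀ j, Literature.Analysis.FunctionSpaces.Torus.IsSmooth (u₀ j))
    (hu : ∀ j, Torus.IsGlobalLerayHopf (ν j) (fun _ => Φ.force n F) (u₀ j) (u j))
    {Ubar : ℝ} (hU : ∀ j, 0 < rmsVelocity longTimeAvgSup (u j) ∧
      rmsVelocity longTimeAvgSup (u j) ≤ Ubar) :
    Tendsto (fun j => meanDissipation (ν j) (u j)) atTop (nhds 0) :=
  AlexakisDoering2006_energyDissipationBound_holds.no_twoDimensional_zerothLaw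
    Φ hn F ν hν hν₀ u₀ u hu₀ hu hU

end Discharge

end Literature.Barriers.AnomalousDissipation

end
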